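import Mathlib.Analysis.SpecificLimits.Basic

/-!
# Crux `BoundedResponseConverges` (stmt-AtomisticToContinuum-9141), line `comonotone-local-resistance`: exchange-of-limits glue

Lead c3 helper (pure real analysis, no chain input, no definitions): the glue of the planner skeleton
`Cruxes/BoundedResponseConverges/Lines/comonotone_local_resistance.lean`, moved here verbatim so the line's composition
can be cited. `exchange_of_limits`: series law `R N = 2/γ + Σ_{b<N−1} r N b` + bounded response `1/S ≤ R N/(N−1)` +
reflection `r N b = r N (N−2−b)` + S1 (inward quasi-ordering, slack `s → 0`) + S2 (length quasi-monotonicity at fixed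
depth, slack `η → 0`) + S3 (fixed-depth bounds `B`) ⇒ `R N/(N−1) → r∞ ≥ 1/S` (`ℓ_d := inf_N r N d`, `r∞ := liminf_d ℓ_d`;
upper bound through one depth via S1+S2+S3, lower bound: every bond dominates its own column infimum). [folklore]
-/

noncomputable section

namespace Summit.AtomisticToContinuum.FouriersLaw.Cruxes.BoundedResponseConverges.ComonotoneLocalResistance.Glue

open Filter Topology

/-- A real sequence bounded on a tail (where a side condition holds) is bounded wherever it holds. [folklore] -/
theorem abs_le_of_tail (f : ℕ → ℝ) (K : ℕ) (B : ℝ) (P : ℕ → Prop)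
    (h : ∀ n, K ≤ n → P n → |f n| ≤ B) : ∃ B' : ℝ, ∀ n, P n → |f n| ≤ B' := by
  refine ⟨|B| + ∑ m ∈ Finset.range K, |f m|, fun n hn => ?_⟩
  have hsum : 0 ≤ ∑ m ∈ Finset.range K, |f m| := Finset.sum_nonneg (fun m _ => abs_nonneg _)
  by_cases hK : K ≤ n
  · linarith [h n hK hn, le_abs_self B]
  · have h3 : |f n| ≤ ∑ m ∈ Finset.range K, |f m| :=
      Finset.single_le_sum (fun m _ => abs_nonneg (f m)) (Finset.mem_range.mpr (by omega))
    linarith [abs_nonneg B]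

/-- A real sequence tending to `0` is bounded in absolute value. [folklore] -/
theorem abs_le_of_tendsto_zero (f : ℕ → ℝ) (hf : Tendsto f atTop (𝓝 0)) : ∃ C : ℝ, ∀ n, |f n| ≤ C := by
  obtain ⟨K, hK⟩ := Metric.tendsto_atTop.mp hf 1 one_pos
  obtain ⟨C, hC⟩ := abs_le_of_tail f K 1 (fun _ => True) (fun n hn _ => by simpa [Real.dist_eq] using (hK n hn).le)
  exact ⟨C, fun n => hC n trivial⟩

/-- Indicator sums over a long range are dominated by the full short sum. [folklore] -/
theorem sum_indicator_le (n ℓ : ℕ) (g : ℕ → ℝ) (hg : ∀ i, 0 ≤ g i) :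
    ∑ i ∈ Finset.range n, (if i < ℓ then g i else 0) ≤ ∑ i ∈ Finset.range ℓ, g i := by
  rw [← Finset.sum_filter]
  apply Finset.sum_le_sum_of_subset_of_nonneg
  · intro i hi
    rw [Finset.mem_filter] at hi
    exact Finset.mem_range.mpr hi.2
  · intro i _ _
    exact hg i

/-- Term-wise to sum: if every term of a sum over `range n` is at most `x` plus a two-sided boundary correction
(indicator of the `M` leftmost and `M` rightmost indices, height `c ≥ 0`), the sum is at most `n·x + 2·M·c`. [folklore] -/
theorem sum_le_of_termwise (n M : ℕ) (x c : ℝ) (hc : 0 ≤ c) (f : ℕ → ℝ)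
    (h : ∀ b, b < n → f b ≤ x + ((if b < M then c else 0) + (if n - 1 - b < M then c else 0))) :
    ∑ b ∈ Finset.range n, f b ≤ (n : ℝ) * x + 2 * ((M : ℝ) * c) := by
  set G : ℕ → ℝ := fun e => if e < M then c else 0 with hG
  have step1 : ∑ b ∈ Finset.range n, f b ≤ ∑ b ∈ Finset.range n, (x + (G b + G (n - 1 - b))) :=
    Finset.sum_le_sum fun b hb => h b (Finset.mem_range.mp hb)
  have step2 : ∑ b ∈ Finset.range n, (x + (G b + G (n - 1 - b))) =
      (n : ℝ) * x + (∑ b ∈ Finset.range n, G b + ∑ b ∈ Finset.range n, G (n - 1 - b)) := by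
    rw [Finset.sum_add_distrib, Finset.sum_add_distrib, Finset.sum_const, Finset.card_range,
      nsmul_eq_mul]
  have step3 : ∑ b ∈ Finset.range n, G (n - 1 - b) = ∑ b ∈ Finset.range n, G b :=
    Finset.sum_range_reflect G n
  have step4 : ∑ b ∈ Finset.range n, G b ≤ (M : ℝ) * c := by
    calc ∑ b ∈ Finset.range n, G b ≤ ∑ b ∈ Finset.range M, (fun _ => c) b :=
          sum_indicator_le n M (fun _ => c) (fun _ => hc)
      _ = (M : ℝ) * c := by rw [Finset.sum_const, Finset.card_range, nsmul_eq_mul]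
  rw [step2, step3] at step1
  linarith

/-- **Exchange of the two spatial limits (the line's glue)**: series law `hL`, bounded response `hB`, reflection
`hRefl`, S1 `hC1`, S2 `hC3`, S3 `hBd` ⇒ `R N/(N−1) → r∞ ≥ 1/S` (see the module docstring). [folklore] -/
theorem exchange_of_limits_core (γ S : ℝ) (R : ℕ → ℝ) (r : ℕ → ℕ → ℝ) (Nst ι : ℕ) (s η B : ℕ → ℝ)
    (hγ : 0 < γ) (hN2 : 2 ≤ Nst)
    (hs : Tendsto s atTop (𝓝 0)) (hη : Tendsto η atTop (𝓝 0))
    (hL : ∀ N, Nst ≤ N → R N = 2 / γ + ∑ b ∈ Finset.range (N - 1), r N b)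
    (hB : ∀ N, Nst ≤ N → 1 / S ≤ R N / ((N : ℝ) - 1))
    (hRefl : ∀ N b, Nst ≤ N → b + 2 ≤ N → r N b = r N (N - 2 - b))
    (hC1 : ∀ N i j, Nst ≤ N → ι ≤ i → i ≤ j → 2 * j + 2 ≤ N → r N j ≤ r N i + s i)
    (hC3 : ∀ N N' i, Nst ≤ N → N ≤ N' → ι ≤ i → 2 * i + 2 ≤ N → r N' i ≤ r N i + η i)
    (hBd : ∀ N j, Nst ≤ N → 2 * j + 2 ≤ N → |r N j| ≤ B j) :
    ∃ rinf : ℝ, 1 / S ≤ rinf ∧ Tendsto (fun N : ℕ => R N / ((N : ℝ) - 1)) atTop (𝓝 rinf) := by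
  -- bounds on the slacks
  obtain ⟨Cs, hCs⟩ := abs_le_of_tendsto_zero s hs
  obtain ⟨Cη, hCη⟩ := abs_le_of_tendsto_zero η hη
  have hCs0 : 0 ≤ Cs := le_trans (abs_nonneg _) (hCs 0)
  -- the columns and their infima
  set ν : ℕ → ℕ := fun e => max Nst (2 * e + 2) with hν
  have hνN : ∀ e, Nst ≤ ν e := fun e => le_max_left _ _
  have hνd : ∀ e, 2 * e + 2 ≤ ν e := fun e => le_max_right _ _
  have hcol_bdd : ∀ e, BddBelow (Set.range fun n : ℕ => r (n + ν e) e) := by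
    intro e
    refine ⟨-B e, ?_⟩
    rintro _ ⟨n, rfl⟩
    have h := hBd (n + ν e) e (le_trans (hνN e) (Nat.le_add_left _ _))
      (le_trans (hνd e) (Nat.le_add_left _ _))
    exact (abs_le.mp h).1
  set ℓ : ℕ → ℝ := fun e => ⨅ n : ℕ, r (n + ν e) e with hℓ
  have hℓ_le : ∀ N e, Nst ≤ N → 2 * e + 2 ≤ N → ℓ e ≤ r N e := by
    intro N e hN he
    have hle : ν e ≤ N := max_le hN he
    obtain ⟨n, hn⟩ : ∃ n, N = n + ν e := ⟨N - ν e, (Nat.sub_add_cancel hle).symm⟩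
    rw [hn]
    exact ciInf_le (hcol_bdd e) n
  -- S2 turns the column infimum into an eventual upper bound
  have hcol_up : ∀ e, ι ≤ e → ∀ ε : ℝ, 0 < ε → ∃ Nε : ℕ, Nst ≤ Nε ∧ 2 * e + 2 ≤ Nε ∧
      ∀ N, Nε ≤ N → r N e ≤ ℓ e + η e + ε := by
    intro e he ε hε
    obtain ⟨n, hn⟩ : ∃ n : ℕ, r (n + ν e) e < ℓ e + ε := by
      apply exists_lt_of_ciInf_lt
      show ℓ e < ℓ e + ε
      linarith
    refine ⟨n + ν e, le_trans (hνN e) (Nat.le_add_left _ _),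
      le_trans (hνd e) (Nat.le_add_left _ _), fun N hN => ?_⟩
    have h := hC3 (n + ν e) N e (le_trans (hνN e) (Nat.le_add_left _ _)) hN he
      (le_trans (hνd e) (Nat.le_add_left _ _))
    linarith
  -- per-depth bound sums
  set Bsum : ℕ → ℝ := fun M => ∑ e ∈ Finset.range M, |B e| with hBsum
  have hBsum_nn : ∀ M, 0 ≤ Bsum M := fun M => Finset.sum_nonneg fun e _ => abs_nonneg _
  have hB_le_Bsum : ∀ M e, e < M → B e ≤ Bsum M := fun M e he =>
    le_trans (le_abs_self _)
      (Finset.single_le_sum (fun e _ => abs_nonneg (B e)) (Finset.mem_range.mpr he))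
  have hB_nn : ∀ e, 0 ≤ B e := fun e =>
    le_trans (abs_nonneg _) (hBd (ν e) e (hνN e) (hνd e))
  -- UPPER ESTIMATE at one depth M
  have hupper : ∀ M N, ι ≤ M → Nst ≤ N → 2 * M + 2 ≤ N →
      R N ≤ 2 / γ + ((N : ℝ) - 1) * (r N M + s M) + 2 * ((M : ℝ) * (Bsum M + |r N M + s M|)) := by
    intro M N hM hN hMN
    set x : ℝ := r N M + s M with hx
    have hot : ∀ e, 2 * e + 2 ≤ N → r N e ≤ x + (if e < M then Bsum M + |x| else 0) := by
      intro e he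
      by_cases heM : e < M
      · have h1 : r N e ≤ B e := (abs_le.mp (hBd N e hN he)).2
        have h2 := hB_le_Bsum M e heM
        rw [if_pos heM]
        linarith [neg_abs_le x]
      · have heM' : M ≤ e := not_lt.mp heM
        have h1 := hC1 N M e hN hM heM' he
        rw [if_neg heM]
        linarith
    have hnn : ∀ e, 0 ≤ (if e < M then Bsum M + |x| else 0) := by
      intro e
      split_ifs
      · have := hBsum_nn M
        have := abs_nonneg x
        linarith
      · exact le_rfl
    have hterm : ∀ b, b < N - 1 → r N b ≤ x + ((if b < M then Bsum M + |x| else 0) +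
        (if N - 1 - 1 - b < M then Bsum M + |x| else 0)) := by
      intro b hb
      have e1 : N - 1 - 1 - b = N - 2 - b := by omega
      rw [e1]
      by_cases hhalf : 2 * b + 2 ≤ N
      · have h1 := hot b hhalf
        have h2 := hnn (N - 2 - b)
        linarith
      · rw [hRefl N b hN (by omega)]
        have h1 := hot (N - 2 - b) (by omega)
        have h2 := hnn b
        linarith
    have hsum := sum_le_of_termwise (N - 1) M x (Bsum M + |x|) (by
      have := hBsum_nn M
      have := abs_nonneg x
      linarith) (fun b => r N b) hterm
    have hN1 : 1 ≤ N := by omega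
    rw [Nat.cast_sub hN1, Nat.cast_one] at hsum
    rw [hL N hN]
    linarith
  -- UPPER BOUND: eventually R N/(N-1) ≤ ℓ M + η M + s M + ε
  have hupper' : ∀ M, ι ≤ M → ∀ ε : ℝ, 0 < ε →
      ∃ N₂ : ℕ, ∀ N, N₂ ≤ N → R N / ((N : ℝ) - 1) ≤ ℓ M + η M + s M + ε := by
    intro M hM ε hε
    obtain ⟨Nε, hNε1, hNε2, hNε⟩ := hcol_up M hM (ε / 2) (by linarith)
    set C : ℝ := 2 / γ + 2 * ((M : ℝ) * (Bsum M + (B M + Cs))) with hC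
    have hC0 : 0 ≤ C := by
      have h1 : 0 < 2 / γ := div_pos two_pos hγ
      have h2 : 0 ≤ (M : ℝ) := Nat.cast_nonneg M
      have h3 : 0 ≤ Bsum M + (B M + Cs) := by
        have := hBsum_nn M
        have := hB_nn M
        linarith
      have h4 : 0 ≤ (M : ℝ) * (Bsum M + (B M + Cs)) := mul_nonneg h2 h3
      linarith
    obtain ⟨K, hK⟩ : ∃ K : ℕ, C / (ε / 2) ≤ (K : ℝ) := exists_nat_ge _
    refine ⟨Nε + K + 2, fun N hN => ?_⟩
    have hNNε : Nε ≤ N := by omega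
    have hNst : Nst ≤ N := le_trans hNε1 hNNε
    have hMN : 2 * M + 2 ≤ N := le_trans hNε2 hNNε
    have hN1 : (0 : ℝ) < (N : ℝ) - 1 := by
      have : (2 : ℝ) ≤ (N : ℝ) := by exact_mod_cast (show 2 ≤ N by omega)
      linarith
    have hKN : (K : ℝ) + 1 ≤ (N : ℝ) - 1 := by
      have : ((K + 2 : ℕ) : ℝ) ≤ (N : ℝ) := by exact_mod_cast (show K + 2 ≤ N by omega)
      push_cast at this
      linarith
    have h1 := hupper M N hM hNst hMN
    have h2 := hNε N hNNε
    -- |x| ≤ B M + Cs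
    have hxabs : |r N M + s M| ≤ B M + Cs := by
      have ha : |r N M| ≤ B M := hBd N M hNst hMN
      have hb : |s M| ≤ Cs := hCs M
      calc |r N M + s M| ≤ |r N M| + |s M| := abs_add_le _ _
        _ ≤ B M + Cs := by linarith
    have hM0 : 0 ≤ (M : ℝ) := Nat.cast_nonneg M
    have h3 : 2 * ((M : ℝ) * (Bsum M + |r N M + s M|)) ≤ 2 * ((M : ℝ) * (Bsum M + (B M + Cs))) := by
      have : (M : ℝ) * (Bsum M + |r N M + s M|) ≤ (M : ℝ) * (Bsum M + (B M + Cs)) :=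
        mul_le_mul_of_nonneg_left (by linarith) hM0
      linarith
    -- R N ≤ (N-1) x + C
    have h4 : R N ≤ ((N : ℝ) - 1) * (r N M + s M) + C := by
      rw [hC]
      linarith
    -- C ≤ (ε/2) (N-1)
    have h5 : C ≤ (ε / 2) * ((N : ℝ) - 1) := by
      have hε2 : 0 < ε / 2 := by linarith
      have := (div_le_iff₀ hε2).mp hK
      nlinarith
    rw [div_le_iff₀ hN1]
    nlinarith
  -- uniform lower bound on the infima (bounded response enters here)
  have hℓ_low : ∀ M, ι ≤ M → 1 / S - Cη - Cs ≤ ℓ M := by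
    intro M hM
    have h : 1 / S ≤ ℓ M + η M + s M := by
      apply le_of_forall_pos_le_add
      intro ε hε
      obtain ⟨N₂, hN₂⟩ := hupper' M hM ε hε
      have h1 := hB (max N₂ Nst) (le_max_right _ _)
      have h2 := hN₂ (max N₂ Nst) (le_max_left _ _)
      linarith
    have hη1 : η M ≤ Cη := le_trans (le_abs_self _) (hCη M)
    have hs1 : s M ≤ Cs := le_trans (le_abs_self _) (hCs M)
    linarith
  -- depth monotonicity of the infima, up to slack
  have hℓ_up : ∀ M e, ι ≤ M → M ≤ e → ℓ e ≤ ℓ M + η M + s M := by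
    intro M e hM hMe
    apply le_of_forall_pos_le_add
    intro ε hε
    obtain ⟨Nε, hNε1, _, hNε⟩ := hcol_up M hM ε hε
    have hN1 : Nε ≤ max Nε (2 * e + 2) := le_max_left _ _
    have hN2 : 2 * e + 2 ≤ max Nε (2 * e + 2) := le_max_right _ _
    have hNst : Nst ≤ max Nε (2 * e + 2) := le_trans hNε1 hN1
    have h1 := hℓ_le (max Nε (2 * e + 2)) e hNst hN2
    have h2 := hC1 (max Nε (2 * e + 2)) M e hNst hM hMe hN2
    have h3 := hNε (max Nε (2 * e + 2)) hN1
    linarith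
  -- the liminf of the infima over depths
  set m₀ : ℝ := 1 / S - Cη - Cs with hm₀
  set Utop : ℝ := ℓ ι + η ι + s ι with hUtop
  set L : ℕ → ℝ := fun n => ℓ (n + ι) with hLdef
  have hL_low : ∀ n, m₀ ≤ L n := fun n => hℓ_low (n + ι) (Nat.le_add_left _ _)
  have hL_up : ∀ n, L n ≤ Utop := fun n => hℓ_up ι (n + ι) le_rfl (Nat.le_add_left _ _)
  set g : ℕ → ℝ := fun J => ⨅ n : ℕ, L (n + J) with hgdef
  have hg_bddBelow : ∀ J, BddBelow (Set.range fun n : ℕ => L (n + J)) := fun J =>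
    ⟨m₀, by rintro _ ⟨n, rfl⟩; exact hL_low _⟩
  have hg_le : ∀ J n, g J ≤ L (n + J) := fun J n => ciInf_le (hg_bddBelow J) n
  have hg_up : ∀ J, g J ≤ Utop := fun J => le_trans (hg_le J 0) (hL_up _)
  have hg_mono : Monotone g := by
    refine monotone_nat_of_le_succ fun J => ?_
    refine le_ciInf fun n => ?_
    have h := hg_le J (n + 1)
    have e : n + 1 + J = n + (J + 1) := by omega
    rw [e] at h
    exact h
  have hg_bddAbove : BddAbove (Set.range g) := ⟨Utop, by rintro _ ⟨J, rfl⟩; exact hg_up J⟩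
  set rinf : ℝ := ⨆ J, g J with hrinf
  have hg_le_rinf : ∀ J, g J ≤ rinf := fun J => le_ciSup hg_bddAbove J
  -- UPPER LIMIT
  have hlim_up : ∀ ε : ℝ, 0 < ε → ∃ N₃ : ℕ, ∀ N, N₃ ≤ N → R N / ((N : ℝ) - 1) ≤ rinf + ε := by
    intro ε hε
    obtain ⟨K₁, hK₁⟩ := Metric.tendsto_atTop.mp hη (ε / 4) (by linarith)
    obtain ⟨K₂, hK₂⟩ := Metric.tendsto_atTop.mp hs (ε / 4) (by linarith)
    obtain ⟨n, hn⟩ : ∃ n : ℕ, L (n + (K₁ + K₂)) < g (K₁ + K₂) + ε / 4 := by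
      apply exists_lt_of_ciInf_lt
      show g (K₁ + K₂) < g (K₁ + K₂) + ε / 4
      linarith
    have hMι : ι ≤ n + (K₁ + K₂) + ι := Nat.le_add_left _ _
    obtain ⟨N₂, hN₂⟩ := hupper' (n + (K₁ + K₂) + ι) hMι (ε / 4) (by linarith)
    refine ⟨N₂, fun N hN => ?_⟩
    have h1 := hN₂ N hN
    have h2 : ℓ (n + (K₁ + K₂) + ι) < g (K₁ + K₂) + ε / 4 := hn
    have h3 : g (K₁ + K₂) ≤ rinf := hg_le_rinf _
    have h4 := hK₁ (n + (K₁ + K₂) + ι) (by omega)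
    have h5 := hK₂ (n + (K₁ + K₂) + ι) (by omega)
    rw [Real.dist_eq, sub_zero] at h4 h5
    have h4' := (abs_lt.mp h4).2
    have h5' := (abs_lt.mp h5).2
    linarith
  -- LOWER LIMIT
  have hlim_low : ∀ ε : ℝ, 0 < ε → ∃ N₄ : ℕ, ∀ N, N₄ ≤ N → rinf - ε ≤ R N / ((N : ℝ) - 1) := by
    intro ε hε
    obtain ⟨J, hJ⟩ : ∃ J : ℕ, rinf - ε / 2 < g J := by
      apply exists_lt_of_lt_ciSup
      show rinf - ε / 2 < rinf
      linarith
    have hdeep : ∀ e, J + ι ≤ e → rinf - ε / 2 ≤ ℓ e := by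
      intro e he
      obtain ⟨n, hn⟩ : ∃ n, e = n + J + ι := ⟨e - J - ι, by omega⟩
      have h1 := hg_le J n
      have h2 : L (n + J) = ℓ e := by
        rw [hn]
      linarith
    set y : ℝ := rinf - ε / 2 with hy
    set J' : ℕ := J + ι with hJ'
    -- term-wise lower bound, summed
    have hlowR : ∀ N, Nst ≤ N → 2 * J' + 2 ≤ N →
        ((N : ℝ) - 1) * y - 2 * ((J' : ℝ) * (Bsum J' + |y|)) ≤ R N := by
      intro N hN hJN
      have hot : ∀ e, 2 * e + 2 ≤ N → -r N e ≤ -y + (if e < J' then Bsum J' + |y| else 0) := by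
        intro e he
        by_cases heJ : e < J'
        · have h1 : -B e ≤ r N e := (abs_le.mp (hBd N e hN he)).1
          have h2 := hB_le_Bsum J' e heJ
          rw [if_pos heJ]
          linarith [le_abs_self y]
        · have heJ' : J' ≤ e := not_lt.mp heJ
          have h1 := hℓ_le N e hN he
          have h2 := hdeep e heJ'
          rw [if_neg heJ]
          linarith
      have hnn : ∀ e, 0 ≤ (if e < J' then Bsum J' + |y| else 0) := by
        intro e
        split_ifs
        · have := hBsum_nn J'
          have := abs_nonneg y
          linarith
        · exact le_rfl
      have hterm : ∀ b, b < N - 1 → -r N b ≤ -y + ((if b < J' then Bsum J' + |y| else 0) +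
          (if N - 1 - 1 - b < J' then Bsum J' + |y| else 0)) := by
        intro b hb
        have e1 : N - 1 - 1 - b = N - 2 - b := by omega
        rw [e1]
        by_cases hhalf : 2 * b + 2 ≤ N
        · have h1 := hot b hhalf
          have h2 := hnn (N - 2 - b)
          linarith
        · rw [hRefl N b hN (by omega)]
          have h1 := hot (N - 2 - b) (by omega)
          have h2 := hnn b
          linarith
      have hsum := sum_le_of_termwise (N - 1) J' (-y) (Bsum J' + |y|) (by
        have := hBsum_nn J'
        have := abs_nonneg y
        linarith) (fun b => -r N b) hterm
      have hN1 : 1 ≤ N := by omega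
      rw [Nat.cast_sub hN1, Nat.cast_one, Finset.sum_neg_distrib] at hsum
      rw [hL N hN]
      have : 0 < 2 / γ := div_pos two_pos hγ
      linarith
    set C : ℝ := 2 * ((J' : ℝ) * (Bsum J' + |y|)) with hC
    have hC0 : 0 ≤ C := by
      have h2 : 0 ≤ (J' : ℝ) := Nat.cast_nonneg J'
      have h3 : 0 ≤ Bsum J' + |y| := by
        have := hBsum_nn J'
        have := abs_nonneg y
        linarith
      have := mul_nonneg h2 h3
      rw [hC]
      linarith
    obtain ⟨K, hK⟩ : ∃ K : ℕ, C / (ε / 2) ≤ (K : ℝ) := exists_nat_ge _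
    refine ⟨Nst + (2 * J' + 2) + K + 2, fun N hN => ?_⟩
    have hNst : Nst ≤ N := by omega
    have hJN : 2 * J' + 2 ≤ N := by omega
    have hN1 : (0 : ℝ) < (N : ℝ) - 1 := by
      have : (2 : ℝ) ≤ (N : ℝ) := by exact_mod_cast (show 2 ≤ N by omega)
      linarith
    have hKN : (K : ℝ) + 1 ≤ (N : ℝ) - 1 := by
      have : ((K + 2 : ℕ) : ℝ) ≤ (N : ℝ) := by exact_mod_cast (show K + 2 ≤ N by omega)
      push_cast at this
      linarith
    have h1 := hlowR N hNst hJN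
    have h5 : C ≤ (ε / 2) * ((N : ℝ) - 1) := by
      have hε2 : 0 < ε / 2 := by linarith
      have := (div_le_iff₀ hε2).mp hK
      nlinarith
    rw [le_div_iff₀ hN1]
    nlinarith
  -- CONVERGENCE and the floor
  have hT : Tendsto (fun N : ℕ => R N / ((N : ℝ) - 1)) atTop (𝓝 rinf) := by
    rw [Metric.tendsto_atTop]
    intro ε hε
    obtain ⟨N₃, hN₃⟩ := hlim_up (ε / 2) (by linarith)
    obtain ⟨N₄, hN₄⟩ := hlim_low (ε / 2) (by linarith)
    refine ⟨max N₃ N₄, fun N hN => ?_⟩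
    have h1 := hN₃ N (le_trans (le_max_left _ _) hN)
    have h2 := hN₄ N (le_trans (le_max_right _ _) hN)
    rw [Real.dist_eq, abs_lt]
    constructor <;> linarith
  have hfloor : 1 / S ≤ rinf :=
    ge_of_tendsto hT (Filter.eventually_atTop.mpr ⟨Nst, fun N hN => hB N hN⟩)
  exact ⟨rinf, hfloor, hT⟩

/-- **Exchange of the two spatial limits** — registered sub-goal `exchange_of_limits` of crux stmt-9141 (curried
restatement of `exchange_of_limits_core`). [folklore] -/
theorem exchange_of_limits : ∀ (γ S : ℝ) (R : ℕ → ℝ) (r : ℕ → ℕ → ℝ) (Nst ι : ℕ) (s η B : ℕ → ℝ), 0 < γ → 2 ≤ Nst → Filter.Tendsto s Filter.atTop (nhds 0) → Filter.Tendsto η Filter.atTop (nhds 0) → (∀ N, Nst ≤ N → R N = 2 / γ + ∑ b ∈ Finset.range (N - 1), r N b) → (∀ N, Nst ≤ N → 1 / S ≤ R N / ((N : ℝ) - 1)) → (∀ N b, Nst ≤ N → b + 2 ≤ N → r N b = r N (N - 2 - b)) → (∀ N i j, Nst ≤ N → ι ≤ i → i ≤ j → 2 * j + 2 ≤ N → r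 N j ≤ r N i + s i) → (∀ N N' i, Nst ≤ N → N ≤ N' → ι ≤ i → 2 * i + 2 ≤ N → r N' i ≤ r N i + η i) → (∀ N j, Nst ≤ N → 2 * j + 2 ≤ N → |r N j| ≤ B j) → ∃ rinf : ℝ, 1 / S ≤ rinf ∧ Filter.Tendsto (fun N : ℕ => R N / ((N : ℝ) - 1)) Filter.atTop (nhds rinf) :=
  fun γ S R r Nst ι s η B hγ hN2 hs hη hL hB hRefl hC1 hC3 hBd =>
    exchange_of_limits_core γ S R r Nst ι s η B hγ hN2 hs hη hL hB hRefl hC1 hC3 hBd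

end Summit.AtomisticToContinuum.FouriersLaw.Cruxes.BoundedResponseConverges.ComonotoneLocalResistance.Glue

end
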